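import Summits.PneNP.PneNP.Theorems.ChebyshevTracialDesignBlockMaskBulk
import Summits.PneNP.PneNP.Theorems.ChebyshevTracialDesignCrossingPlaneExp
import HarnessLib

/-!
# Cell pnp-psdrank, route `ChebyshevTracialDesign`: THE UNTILTED H-SYMMETRIC MASK AT `e^{−a′D}` — ASYMPTOTIC FORM PER NON-ALIGNED
# MATCHING — brick 128b (crux `TracialDecayExp20`, stmt-PneNP-19878)

Brick 128b (prover g25; MEMO-28 §4 (a)). Brick 128a (`blockMask_value_le_of_type`) prices the plain block statistic `ψ(|U∩H|)` per
non-aligned matching by `B_v·C((T−1)/2,D+1)·G·ρ^{D+1}·X + 2^{D+1}G(D+1)2(n/2+1)³e^{−K²D}` with the smoothness number `X` explicit in the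
type. Here, exactly as bricks 126/127 did for the tilted class: the asymptotic bookkeeping (`…CrossingPlaneExpTools.numerics`, scale
`P = n^{1/4}`, `T·q ≤ e^{−2a′}`, `(4T)^{D+1}e^{−β₀n/64} ≤ e^{−a′D}`), the average over all matchings (non-aligned ones at `β = 1/40`, aligned ones by
the engine's crossing-count tails and the trivial bound `|V(M)| ≤ G·B_v`), and the corollary in the crux's parameters.

* §1 **`blockMask_value_le_exp`**: ∀ `β > 0`, `a′ > 0` ∃ `n₀` ∀ `n ≥ n₀`, every balanced exact design (`1 ≤ D`, `D⁴ ≤ n`, `2D+1 ≤ T ≤ 7⌊√n⌋`),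
  every `M` and balanced `H` (`2|H| = n`) with `βn ≤ b_M(H) ≤ (½−β)n`, every `0 ≤ ψ ≤ G`:
  `|PM|·Σ_U W(U,M)·ψ(|U∩H|) ≤ 4·(1+B_v)·G·n⁴·e^{−a′D}`.
(The average over all matchings and the corollary in the crux's parameters are the companion file `…BlockMaskAverage`.)
READING: the design value of EVERY `H`-symmetric mask `ψ(|U∩H|)` (`0 ≤ ψ ≤ G`, `|H| = n/2`) against the crux's weight is super-polynomially
small — brick 118c's `−E₁[ψ] + O(G/n)` sharpened to `e^{−a′D}` precision and averaged: virtual positivity for the untilted H-symmetric class,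
unconditional, ASYMPTOTIC ONLY. WHAT THIS FILE DOES NOT DO: unbalanced blocks, several blocks, spread strategies; anything on `TracialDecayExp20`
itself, psd rank of P_PM(K_n), or P vs NP. [cite: Rothvoss2017, §2 (PDF pp. 5–6)] [cite: RollinRoss2010, §4.1 Thm 4.2] [cite: Durrett2019, §2.7]
Stature: support/instrument (kernel lane, no defs, axioms standard). Supports stmt-PneNP-19878.
-/

set_option linter.dupNamespace false -- `Summit.PneNP.PneNP.…`: summit = sub-problem (D-0017)

noncomputable section

namespace Summit.PneNP.PneNP.Theorems.ChebyshevTracialDesignBlockMaskExp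

open Finset Literature.Barriers.PneNP Literature.Combinatorics.Optimization
open Literature.Combinatorics.Optimization.ShellStep
open Summit.PneNP.PneNP.Theorems.ChebyshevTracialDesignBlockMaskBulk (blockMask_value_le_of_type)
open Summit.PneNP.PneNP.Theorems.ChebyshevTracialDesignCrossingPlaneExpTools
open Summit.PneNP.PneNP.Theorems.ChebyshevTracialDesignCrossingPlaneExp (tail_exp_eq)

variable {n : ℕ}

/-! ### §1 The asymptotic form, per non-aligned matching -/

/-- `(e^{−2a′})^{D+1} ≤ e^{−a′D}` for `a′ ≥ 0`. [cite: Durrett2019, §2.7] -/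
theorem exp_pow_succ_le {a' : ℝ} (ha' : 0 ≤ a') (D : ℕ) : Real.exp (-(2 * a')) ^ (D + 1) ≤ Real.exp (-(a' * D)) := by
  rw [← Real.exp_nat_mul]
  refine Real.exp_le_exp.2 ?_
  have : (0 : ℝ) ≤ D := Nat.cast_nonneg _
  push_cast; nlinarith

/-- **The untilted H-symmetric mask per non-aligned matching, asymptotic form (brick 128b §1).** For every `β > 0` and `a′ > 0` there is
`n₀` such that for all `n ≥ n₀`: for every balanced exact design `(n,t,T,D,B_v,C,w)` with `2D+1 ≤ T ≤ 7⌊√n⌋`, `1 ≤ D`, `D⁴ ≤ n`, every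
perfect matching `M` and balanced block `|H| = n/2` with `βn ≤ b_M(H) ≤ (½−β)n`, every `0 ≤ ψ ≤ G` on `[0,t]`:
`|PM|·Σ_U W(U,M)·ψ(|U∩H|) ≤ 4·(1+B_v)·G·n⁴·e^{−a′D}`. [cite: Rothvoss2017, §2 (PDF p. 6)] [cite: RollinRoss2010, §4.1 Thm 4.2] -/
theorem blockMask_value_le_exp {β a' : ℝ} (hβ : 0 < β) (ha' : 0 < a') :
    ∃ n₀ : ℕ, ∀ n : ℕ, n₀ ≤ n → ∀ {t T D : ℕ} {Bv : ℝ} {C : Finset ℕ} {w : ℕ → ℝ},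
    IsExactDesign n t T D Bv C w → 2 * D + 1 ≤ T → n ≤ 4 * t → 1 ≤ D → D ^ 4 ≤ n → T ≤ 7 * Nat.sqrt n →
    ∀ (M : PMatch n) (H : Finset (Fin n)), 2 * H.card = n →
    β * n ≤ (reps M.2.partner (vBH M.2.partner univ H ∪ vBN M.2.partner univ H)).card →
    ((reps M.2.partner (vBH M.2.partner univ H ∪ vBN M.2.partner univ H)).card : ℝ) ≤ (1 / 2 - β) * n →
    ∀ (ψ : ℤ → ℝ) {G : ℝ}, 0 ≤ G → (∀ x ∈ Icc (0 : ℤ) ((t : ℕ) : ℤ), |ψ x| ≤ G) →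
    (∀ x ∈ Icc (0 : ℤ) ((t : ℕ) : ℤ), 0 ≤ ψ x) →
    (Fintype.card (PMatch n) : ℝ) * ∑ U : OddSet n, levelWeight n t C w U M * ψ ((U.1 ∩ H).card : ℤ) ≤
      4 * (1 + Bv) * G * (n : ℝ) ^ 4 * Real.exp (-(a' * D)) := by
  -- constants
  obtain ⟨β₀, hβ₀def⟩ : ∃ e : ℝ, e = min β (1 / 8) := ⟨_, rfl⟩
  have hβ₀pos : 0 < β₀ := by rw [hβ₀def]; exact lt_min hβ (by norm_num)
  have hβ₀8 : β₀ ≤ 1 / 8 := by rw [hβ₀def]; exact min_le_right _ _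
  have hβ₀β : β₀ ≤ β := by rw [hβ₀def]; exact min_le_left _ _
  have hlog2 : 0 < Real.log 2 := Real.log_pos (by norm_num)
  obtain ⟨K, hKdef⟩ : ∃ K : ℝ, K = Real.sqrt (a' + Real.log 2) := ⟨_, rfl⟩
  have hK0 : 0 ≤ K := by rw [hKdef]; exact Real.sqrt_nonneg _
  have hK2 : K ^ 2 = a' + Real.log 2 := by rw [hKdef]; exact Real.sq_sqrt (by linarith)
  obtain ⟨n₁, h128⟩ := blockMask_value_le_of_type (β := β₀ / 2) (K := K) (by positivity) hK0
  obtain ⟨Pstar, hPstar1, hnum⟩ := numerics hβ₀pos hβ₀8 ha'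
  refine ⟨max n₁ ⌈Pstar ^ 4⌉₊, ?_⟩
  intro n hn t T D Bv C w hdes hDT hbal hD1 hD4 hT7 M H hH hblo hbhi ψ G hG0 hG hψ0
  have hn₁ : n₁ ≤ n := le_trans (le_max_left _ _) hn
  have hnP : Pstar ^ 4 ≤ (n : ℝ) :=
    le_trans (Nat.le_ceil _) (by exact_mod_cast le_trans (le_max_right _ _) hn)
  -- the quarter scale and the numerics
  have hPs4 : (1 : ℝ) ≤ Pstar ^ 4 := one_le_pow₀ hPstar1
  have hn1 : (1 : ℝ) ≤ n := hPs4.trans hnP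
  obtain ⟨hP1, hP4, hsqrt, hDle⟩ := quarter_facts hn1
  have hPstar : Pstar ≤ (n : ℝ) ^ ((4 : ℕ) : ℝ)⁻¹ :=
    le_of_pow_le_pow_left₀ (by norm_num) (by linarith)
      (show Pstar ^ 4 ≤ ((n : ℝ) ^ ((4 : ℕ) : ℝ)⁻¹) ^ 4 by rw [hP4]; exact hnP)
  have hDr1 : (1 : ℝ) ≤ D := by exact_mod_cast hD1
  have hD0 : (0 : ℝ) ≤ D := by linarith
  have hDP : (D : ℝ) ≤ (n : ℝ) ^ ((4 : ℕ) : ℝ)⁻¹ := hDle D hD0 (by exact_mod_cast hD4)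
  have hT0 : (0 : ℝ) ≤ T := Nat.cast_nonneg _
  have hTP : (T : ℝ) ≤ 7 * ((n : ℝ) ^ ((4 : ℕ) : ℝ)⁻¹) ^ 2 := by
    rw [← hsqrt]
    have h1 : ((Nat.sqrt n : ℕ) : ℝ) ≤ Real.sqrt n := Real.nat_sqrt_le_real_sqrt
    have h2 : (T : ℝ) ≤ 7 * (Nat.sqrt n : ℕ) := by exact_mod_cast hT7
    linarith
  obtain ⟨c1, c2, c3, c4, c5, c6, c7, c8, c9⟩ := hnum _ hPstar D T hDr1 hDP hT0 hTP
  rw [hP4] at c1 c2 c3 c4 c5 c6 c7 c8 c9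
  have h8 : β₀ * n ≤ 1 / 8 * n := mul_le_mul_of_nonneg_right hβ₀8 (Nat.cast_nonneg (α := ℝ) n)
  -- the type of `M` (no `set` abbreviation for the partner map: MEMO-27 §2)
  have hπ : ∀ v, M.2.partner (M.2.partner v) = v := partner_partner M
  have hπ' : ∀ v, M.2.partner v ≠ v := partner_ne M
  have hst : ∀ v ∈ (univ : Finset (Fin n)), M.2.partner v ∈ univ := fun v _ => mem_univ _
  obtain ⟨a, ha⟩ : ∃ a : ℕ, (reps M.2.partner (vAA M.2.partner univ H)).card = a := ⟨_, rfl⟩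
  obtain ⟨b, hb⟩ : ∃ b : ℕ, (reps M.2.partner (vBH M.2.partner univ H ∪ vBN M.2.partner univ H)).card = b := ⟨_, rfl⟩
  obtain ⟨d, hd⟩ : ∃ d : ℕ, (reps M.2.partner (vDD M.2.partner univ H)).card = d := ⟨_, rfl⟩
  obtain ⟨N, hN⟩ : ∃ N : ℕ, a + b + d = N := ⟨_, rfl⟩
  have hn2 : n = 2 * N := by
    have h := two_mul_typeReps_eq_card hπ hπ' hst H
    rw [ha, hb, hd, card_univ, Fintype.card_fin] at h; omega
  have hHab : H.card = 2 * a + b := by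
    have := card_eq_two_mul_add_of_types hπ hπ' H; rw [ha, hb] at this; exact this
  have had : d = a := by omega
  rw [hb] at hblo hbhi
  have har : (a : ℝ) = ((n : ℝ) / 2 - b) / 2 := by
    have : ((2 * (2 * a + b) : ℕ) : ℝ) = n := by exact_mod_cast (show 2 * (2 * a + b) = n by omega)
    push_cast at this; linarith only [this]
  have hbN : (b : ℝ) ≤ (n : ℝ) / 2 := by
    have : ((2 * b : ℕ) : ℝ) ≤ n := by exact_mod_cast (show 2 * b ≤ n by omega)
    push_cast at this; linarith only [this]
  have hb0 : (0 : ℝ) ≤ b := Nat.cast_nonneg _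
  have hac : ((reps M.2.partner (vAA M.2.partner univ H)).card : ℝ) = a := by exact_mod_cast ha
  have hbc : ((reps M.2.partner (vBH M.2.partner univ H ∪ vBN M.2.partner univ H)).card : ℝ) = b := by exact_mod_cast hb
  have hdc : ((reps M.2.partner (vDD M.2.partner univ H)).card : ℝ) = a := by
    have : ((reps M.2.partner (vDD M.2.partner univ H)).card : ℝ) = d := by exact_mod_cast hd
    rw [this]; exact_mod_cast had
  -- `b ≥ β₀ n`, `a = d ≥ β₀ n/2`
  have hβn : 0 ≤ β₀ * n := by positivity
  have hbβ₀ : β₀ * n ≤ b := le_trans (mul_le_mul_of_nonneg_right hβ₀β (Nat.cast_nonneg _)) hblo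
  have haβ₀ : β₀ * n / 2 ≤ a := by
    have : (b : ℝ) ≤ (1 / 2 - β₀) * n := hbhi.trans (mul_le_mul_of_nonneg_right (by linarith only [hβ₀β]) (Nat.cast_nonneg _))
    rw [har]; linarith only [this]
  -- `B_v ≥ 0`, `t` facts
  have hBv : 0 ≤ Bv := le_trans (sum_nonneg fun c _ => abs_nonneg _) hdes.2.2.2.2.2.2
  have htn : 2 * t + 2 ≤ n := hdes.2.1
  have hTt : T ≤ t := hdes.2.2.1
  have htD : 2 * (D + 1) + 2 ≤ t := by
    have : ((2 * (D + 1) + 2 : ℕ) : ℝ) ≤ t := by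
      have hb' : (n : ℝ) ≤ 4 * t := by exact_mod_cast hbal
      push_cast; linarith only [hb', c1, h8]
    exact_mod_cast this
  obtain ⟨t₁, rfl⟩ : ∃ t₁, t = t₁ + 2 * (D + 1) + 2 := ⟨t - (2 * (D + 1) + 2), by omega⟩
  have httr : (((t₁ + 2 * (D + 1) + 2 : ℕ) : ℝ)) ≤ n := by
    exact_mod_cast (show t₁ + 2 * (D + 1) + 2 ≤ n by omega)
  have httlo : (n : ℝ) / 2 / 2 ≤ ((t₁ + 2 * (D + 1) + 2 : ℕ) : ℝ) := by
    have : (n : ℝ) ≤ 4 * ((t₁ + 2 * (D + 1) + 2 : ℕ) : ℝ) := by exact_mod_cast hbal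
    linarith only [this]
  have httN : (((t₁ + 2 * (D + 1) + 2 : ℕ) : ℝ)) ≤ (n : ℝ) / 2 - 1 := by
    have : ((2 * (t₁ + 2 * (D + 1) + 2) + 2 : ℕ) : ℝ) ≤ n := by exact_mod_cast htn
    push_cast at this ⊢; linarith only [this]
  -- the parameters of brick 125
  obtain ⟨V₀, hV₀def⟩ : ∃ e : ℝ, e = β₀ ^ 4 * n / 128 := ⟨_, rfl⟩
  have hV₀pos : 0 < V₀ := by rw [hV₀def]; positivity
  obtain ⟨r₀, hr₀def⟩ : ∃ r : ℕ, r = ⌈β₀ * (n : ℝ) / 4⌉₊ := ⟨_, rfl⟩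
  have hr₀ge : β₀ * (n : ℝ) / 4 ≤ r₀ := by rw [hr₀def]; exact Nat.le_ceil _
  have hr₀lt : (r₀ : ℝ) < β₀ * ((n : ℝ) / 2) / 2 + 1 := by
    rw [hr₀def]
    have := Nat.ceil_lt_add_one (show 0 ≤ β₀ * (n : ℝ) / 4 by positivity)
    linarith only [this]
  have hm3 : 3 ≤ n - 4 * (D + 1) - 4 := by
    have : 4 * D + 11 ≤ n := by exact_mod_cast (show ((4 * D + 11 : ℕ) : ℝ) ≤ n by push_cast; exact c9)
    omega
  have hmn : n - 4 * (D + 1) - 4 + 4 * (D + 1) ≤ n := by omega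
  -- the margins of brick 124 (`β₀/2`)
  have hm1 : β₀ / 2 * n / 2 + 2 * D + 1 ≤ ((reps M.2.partner (vAA M.2.partner univ H)).card : ℝ) := by linarith only [hac, haβ₀, c1]
  have hm2 : β₀ / 2 * n / 2 + 2 * D + 1 ≤ ((reps M.2.partner (vBH M.2.partner univ H ∪ vBN M.2.partner univ H)).card : ℝ) := by
    linarith only [hbc, hbβ₀, c1, hβn]
  have hm3' : β₀ / 2 * n / 2 + 2 * D + 1 ≤ ((reps M.2.partner (vDD M.2.partner univ H)).card : ℝ) := by linarith only [hdc, haβ₀, c1]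
  -- the margins of brick 118 (`β₁ = β₀/2`)
  have hSlo : (n : ℝ) / 4 + β₀ * n / 2 ≤
      ((reps M.2.partner (vBH M.2.partner univ H ∪ vBN M.2.partner univ H)).card : ℝ) +
        (reps M.2.partner (vDD M.2.partner univ H)).card := by
    rw [hbc, hdc, har]; linarith only [hbβ₀]
  have hShi : ((reps M.2.partner (vBH M.2.partner univ H ∪ vBN M.2.partner univ H)).card : ℝ) +
      (reps M.2.partner (vDD M.2.partner univ H)).card ≤ (n : ℝ) / 2 := by
    rw [hbc, hdc, har]; linarith only [hbN]
  have hβS : β₀ / 2 * (((reps M.2.partner (vBH M.2.partner univ H ∪ vBN M.2.partner univ H)).card : ℝ) +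
      (reps M.2.partner (vDD M.2.partner univ H)).card) ≤ β₀ / 2 * ((n : ℝ) / 2) :=
    mul_le_mul_of_nonneg_left hShi (by positivity)
  have hbT : β₀ / 2 * (((reps M.2.partner (vBH M.2.partner univ H ∪ vBN M.2.partner univ H)).card : ℝ) +
      (reps M.2.partner (vDD M.2.partner univ H)).card) + T + 2 * (D + 2) ≤
      (reps M.2.partner (vBH M.2.partner univ H ∪ vBN M.2.partner univ H)).card := by
    linarith only [hβS, hbc, hbβ₀, c2]
  have hdT : β₀ / 2 * (((reps M.2.partner (vBH M.2.partner univ H ∪ vBN M.2.partner univ H)).card : ℝ) +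
      (reps M.2.partner (vDD M.2.partner univ H)).card) + T + 2 * (D + 2) ≤
      (reps M.2.partner (vDD M.2.partner univ H)).card := by
    linarith only [hβS, hdc, haβ₀, c2]
  have hr₀' : β₀ / 2 * (((reps M.2.partner (vBH M.2.partner univ H ∪ vBN M.2.partner univ H)).card : ℝ) +
      (reps M.2.partner (vDD M.2.partner univ H)).card) ≤ r₀ := by linarith only [hβS, hr₀ge]
  have hsT : ((t₁ + 2 * (D + 1) + 2 : ℕ) : ℝ) / 2 +
      β₀ / 2 * (((reps M.2.partner (vBH M.2.partner univ H ∪ vBN M.2.partner univ H)).card : ℝ) +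
        (reps M.2.partner (vDD M.2.partner univ H)).card) + 2 * T + 4 * (D + 2) + 2 ≤
      ((reps M.2.partner (vBH M.2.partner univ H ∪ vBN M.2.partner univ H)).card : ℝ) +
        (reps M.2.partner (vDD M.2.partner univ H)).card := by
    linarith only [hβS, hSlo, httN, c2]
  have hV₀le : V₀ ≤ (β₀ / 2) ^ 4 * ((((reps M.2.partner (vBH M.2.partner univ H ∪ vBN M.2.partner univ H)).card : ℝ) +
      (reps M.2.partner (vDD M.2.partner univ H)).card) - 4 * (D + 2) - 2 * T) := by
    rw [hV₀def]
    have hle : (n : ℝ) / 8 ≤ (((reps M.2.partner (vBH M.2.partner univ H ∪ vBN M.2.partner univ H)).card : ℝ) +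
        (reps M.2.partner (vDD M.2.partner univ H)).card) - 4 * (D + 2) - 2 * T := by
      linarith only [hSlo, c2, h8, hβn]
    calc β₀ ^ 4 * n / 128 = β₀ ^ 4 / 16 * ((n : ℝ) / 8) := by ring
      _ ≤ β₀ ^ 4 / 16 * ((((reps M.2.partner (vBH M.2.partner univ H ∪ vBN M.2.partner univ H)).card : ℝ) +
          (reps M.2.partner (vDD M.2.partner univ H)).card) - 4 * (D + 2) - 2 * T) :=
          mul_le_mul_of_nonneg_left hle (by positivity)
      _ = _ := by ring
  have hkV : (2 * (D + 1 : ℕ) : ℝ) - 1 ≤ 2 * V₀ := by rw [hV₀def]; push_cast; linarith only [c3]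
  have hNT : (T : ℝ) + 2 < (n : ℝ) / 2 := by linarith only [c4, hn1]
  -- `Ξ` (order `D + 1` only)
  obtain ⟨qq, hqqdef⟩ : ∃ e : ℝ, e = 393216 * ((D : ℝ) + 1) / (β₀ ^ 4 * n) := ⟨_, rfl⟩
  have hqq0 : 0 ≤ qq := by rw [hqqdef]; positivity
  have hqqV : 3072 * ((D : ℝ) + 1) / V₀ = qq := by rw [hqqdef, hV₀def]; field_simp; ring
  obtain ⟨τ₀, hτ₀def⟩ : ∃ e : ℝ, e = Real.exp (-(β₀ * ((n : ℝ) / 2) / 32)) := ⟨_, rfl⟩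
  have hτ₀pos : 0 < τ₀ := by rw [hτ₀def]; exact Real.exp_pos _
  obtain ⟨Ξ, hΞdef⟩ : ∃ e : ℝ, e = qq ^ (D + 1) + (4 : ℝ) ^ (D + 1) * τ₀ := ⟨_, rfl⟩
  have hΞ0 : 0 ≤ Ξ := by rw [hΞdef]; positivity
  -- the Chernoff exponent
  have hE : (β₀ + β₀ ^ 2) * (((t₁ + 2 * (D + 1) + 2 : ℕ) : ℝ) / 2 *
      (reps M.2.partner (vAA M.2.partner univ H)).card / ((n : ℝ) / 2 - T - 2)) -
      β₀ * ((((t₁ + 2 * (D + 1) + 2 : ℕ) : ℝ) - T - 2) / 2 + 1 - r₀) ≤ -(β₀ * ((n : ℝ) / 2) / 32) := by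
    refine chernoff_exponent_le hβ₀pos hβ₀8 ?_ hT0 ?_ ?_ httlo hr₀lt
    · rw [hac, har]; linarith only [hbβ₀]
    · linarith only [c2, hD0, hβn]
    · linarith only [c4]
  -- domination at order `D + 1`
  have hdom : (2 * Real.sqrt 192 * Real.sqrt (4 * (D + 1 : ℕ) / V₀)) ^ (2 * (D + 1)) +
        (4 : ℝ) ^ (D + 1) * Real.exp ((β₀ + β₀ ^ 2) * (((t₁ + 2 * (D + 1) + 2 : ℕ) : ℝ) / 2 *
          (reps M.2.partner (vAA M.2.partner univ H)).card / ((n : ℝ) / 2 - T - 2)) -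
          β₀ * ((((t₁ + 2 * (D + 1) + 2 : ℕ) : ℝ) - T - 2) / 2 + 1 - r₀)) ≤ Ξ := by
    rw [hΞdef]
    refine add_le_add ?_ ?_
    · have hx0 : 0 ≤ 4 * ((D + 1 : ℕ) : ℝ) / V₀ := by positivity
      have h192 : Real.sqrt 192 ^ 2 = 192 := Real.sq_sqrt (by norm_num)
      have hxx : Real.sqrt (4 * ((D + 1 : ℕ) : ℝ) / V₀) ^ 2 = 4 * ((D + 1 : ℕ) : ℝ) / V₀ := Real.sq_sqrt hx0
      have hsq : (2 * Real.sqrt 192 * Real.sqrt (4 * ((D + 1 : ℕ) : ℝ) / V₀)) ^ 2 = qq := by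
        rw [mul_pow, mul_pow, h192, hxx, ← hqqV]; push_cast; ring
      rw [pow_mul, hsq]
    · refine mul_le_mul_of_nonneg_left ?_ (by positivity)
      rw [hτ₀def]; exact Real.exp_le_exp.2 hE
  -- apply brick 128a with `X = Ξ`
  have h := h128 n hn₁ hdes hDT hbal hD1 hD4 M H hm1 hm2 hm3' ψ hG0 hG hψ0 hm3 hmn
    (β₁ := β₀ / 2) (V₀ := V₀) (u := β₀) (r₀ := r₀) (by positivity) hV₀pos hβ₀pos.le (by linarith only [hβ₀8])
    hkV hbT hdT hr₀' hsT hV₀le hNT Ξ hdom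
  -- the remainder term
  have hm3r : (3 : ℝ) ≤ ((n - 4 * (D + 1) - 4 : ℕ) : ℝ) := by exact_mod_cast hm3
  have hρ0 : (0 : ℝ) ≤ ((n - 4 * (D + 1) - 4 : ℕ) : ℝ) / (4 * (((n - 4 * (D + 1) - 4 : ℕ) : ℝ) - 2)) := by
    have : (0 : ℝ) < 4 * (((n - 4 * (D + 1) - 4 : ℕ) : ℝ) - 2) := by linarith only [hm3r]
    positivity
  have hρ1 : ((n - 4 * (D + 1) - 4 : ℕ) : ℝ) / (4 * (((n - 4 * (D + 1) - 4 : ℕ) : ℝ) - 2)) ≤ 1 := by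
    rw [div_le_one (by linarith only [hm3r])]; linarith only [hm3r]
  have hρD : (((n - 4 * (D + 1) - 4 : ℕ) : ℝ) / (4 * (((n - 4 * (D + 1) - 4 : ℕ) : ℝ) - 2))) ^ (D + 1) ≤ 1 :=
    pow_le_one₀ hρ0 hρ1
  have hTqq : (T : ℝ) * qq ≤ Real.exp (-(2 * a')) := by
    rw [hqqdef]; exact le_trans (mul_le_mul_of_nonneg_right hTP (by positivity)) c5
  have hCb : ((((T - 1) / 2).choose (D + 1) : ℕ) : ℝ) ≤ (T : ℝ) ^ (D + 1) := by
    have h1 : ((T - 1) / 2).choose (D + 1) ≤ ((T - 1) / 2) ^ (D + 1) := Nat.choose_le_pow _ _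
    have h2 : ((T - 1) / 2) ^ (D + 1) ≤ T ^ (D + 1) := Nat.pow_le_pow_left (by omega) _
    exact_mod_cast h1.trans h2
  have hTpos : (0 : ℝ) < T := by
    have : ((2 * D + 1 : ℕ) : ℝ) ≤ T := by exact_mod_cast hDT
    push_cast at this; linarith only [this, hD0]
  have hmA : (T : ℝ) ^ (D + 1) * qq ^ (D + 1) ≤ Real.exp (-(a' * D)) := by
    rw [← mul_pow]
    exact (pow_le_pow_left₀ (by positivity) hTqq _).trans (exp_pow_succ_le ha'.le D)
  have hmB : (T : ℝ) ^ (D + 1) * ((4 : ℝ) ^ (D + 1) * τ₀) ≤ Real.exp (-(a' * D)) := by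
    have hc8 : ((D : ℝ) + 1) * (4 * T) + a' * D ≤ β₀ * ((n : ℝ) / 2) / 32 := by
      have : ((D : ℝ) + 1) * (4 * T) ≤ ((D : ℝ) + 1) * (4 * (7 * ((n : ℝ) ^ ((4 : ℕ) : ℝ)⁻¹) ^ 2)) :=
        mul_le_mul_of_nonneg_left (by linarith only [hTP]) (by positivity)
      linarith only [this, c8]
    rw [hτ₀def, ← mul_assoc]; exact mul_pow_four_pow_mul_exp_le hTpos hc8
  have hCbΞ : ((((T - 1) / 2).choose (D + 1) : ℕ) : ℝ) * Ξ ≤ 2 * Real.exp (-(a' * D)) := by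
    calc ((((T - 1) / 2).choose (D + 1) : ℕ) : ℝ) * Ξ ≤ (T : ℝ) ^ (D + 1) * Ξ := mul_le_mul_of_nonneg_right hCb hΞ0
      _ = (T : ℝ) ^ (D + 1) * qq ^ (D + 1) + (T : ℝ) ^ (D + 1) * ((4 : ℝ) ^ (D + 1) * τ₀) := by rw [hΞdef]; ring
      _ ≤ Real.exp (-(a' * D)) + Real.exp (-(a' * D)) := add_le_add hmA hmB
      _ = 2 * Real.exp (-(a' * D)) := by ring
  have hrem : Bv * ((((T - 1) / 2).choose (D + 1) : ℕ) : ℝ) * (G * ((((n - 4 * (D + 1) - 4 : ℕ) : ℝ) /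
      (4 * (((n - 4 * (D + 1) - 4 : ℕ) : ℝ) - 2))) ^ (D + 1) * Ξ)) ≤ Bv * (G * (2 * Real.exp (-(a' * D)))) := by
    have h1 : (((n - 4 * (D + 1) - 4 : ℕ) : ℝ) / (4 * (((n - 4 * (D + 1) - 4 : ℕ) : ℝ) - 2))) ^ (D + 1) * Ξ ≤ Ξ :=
      mul_le_of_le_one_left hΞ0 hρD
    calc Bv * ((((T - 1) / 2).choose (D + 1) : ℕ) : ℝ) * (G * ((((n - 4 * (D + 1) - 4 : ℕ) : ℝ) /
          (4 * (((n - 4 * (D + 1) - 4 : ℕ) : ℝ) - 2))) ^ (D + 1) * Ξ))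
        ≤ Bv * ((((T - 1) / 2).choose (D + 1) : ℕ) : ℝ) * (G * Ξ) := by gcongr
      _ = Bv * (G * (((((T - 1) / 2).choose (D + 1) : ℕ) : ℝ) * Ξ)) := by ring
      _ ≤ Bv * (G * (2 * Real.exp (-(a' * D)))) := by gcongr
  -- the tail
  have hHr : (H.card : ℝ) = (n : ℝ) / 2 := by
    have : ((2 * H.card : ℕ) : ℝ) = n := by exact_mod_cast hH
    push_cast at this; linarith only [this]
  have hHpos : (0 : ℝ) < H.card := by rw [hHr]; linarith only [hn1]
  have hn4 : (4 : ℝ) ≤ n := by linarith only [c9, hD0]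
  have htail : (2 : ℝ) ^ (D + 1) * G * (((D : ℝ) + 1) * (2 * ((n : ℝ) / 2 + 1) ^ 3 *
      Real.exp (-((K * Real.sqrt (H.card * D)) ^ 2 / H.card)))) ≤ 4 * G * (n : ℝ) ^ 4 * Real.exp (-(a' * D)) := by
    rw [tail_exp_eq hHpos hD0, hK2]
    have e2 : (2 : ℝ) ^ (D + 1) * Real.exp (-((a' + Real.log 2) * D)) = 2 * Real.exp (-(a' * D)) := by
      have h2D : (2 : ℝ) ^ D = Real.exp (((D : ℕ) : ℝ) * Real.log 2) := by
        rw [Real.exp_nat_mul, Real.exp_log (by norm_num)]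
      rw [pow_succ, h2D, show -((a' + Real.log 2) * D) = -(a' * D) + -(((D : ℕ) : ℝ) * Real.log 2) by ring,
        Real.exp_add, Real.exp_neg (((D : ℕ) : ℝ) * Real.log 2)]
      have : Real.exp (((D : ℕ) : ℝ) * Real.log 2) ≠ 0 := (Real.exp_pos _).ne'
      field_simp
    have hD1n : (D : ℝ) + 1 ≤ n := by linarith only [c9]
    have hn2' : (n : ℝ) / 2 + 1 ≤ n := by linarith only [hn4]
    have hn20 : (0 : ℝ) ≤ (n : ℝ) / 2 + 1 := by linarith only [hn1]
    calc (2 : ℝ) ^ (D + 1) * G * (((D : ℝ) + 1) * (2 * ((n : ℝ) / 2 + 1) ^ 3 * Real.exp (-((a' + Real.log 2) * D))))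
        = G * (((D : ℝ) + 1) * (2 * ((n : ℝ) / 2 + 1) ^ 3)) * ((2 : ℝ) ^ (D + 1) * Real.exp (-((a' + Real.log 2) * D))) := by
          ring
      _ = G * (((D : ℝ) + 1) * (2 * ((n : ℝ) / 2 + 1) ^ 3)) * (2 * Real.exp (-(a' * D))) := by rw [e2]
      _ ≤ G * ((n : ℝ) * (2 * (n : ℝ) ^ 3)) * (2 * Real.exp (-(a' * D))) := by gcongr
      _ = 4 * G * (n : ℝ) ^ 4 * Real.exp (-(a' * D)) := by ring
  -- assemble
  refine h.trans ((add_le_add hrem htail).trans ?_)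
  have hn14 : (1 : ℝ) ≤ (n : ℝ) ^ 4 := one_le_pow₀ hn1
  have he0 : 0 ≤ Real.exp (-(a' * D)) := (Real.exp_pos _).le
  have k0 : 0 ≤ Bv * G * Real.exp (-(a' * D)) := mul_nonneg (mul_nonneg hBv hG0) he0
  have k1 : Bv * G * Real.exp (-(a' * D)) * 1 ≤ Bv * G * Real.exp (-(a' * D)) * (n : ℝ) ^ 4 :=
    mul_le_mul_of_nonneg_left hn14 k0
  have k2 : 0 ≤ Bv * G * Real.exp (-(a' * D)) * (n : ℝ) ^ 4 := mul_nonneg k0 (by positivity)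
  linarith only [k1, k2]

end Summit.PneNP.PneNP.Theorems.ChebyshevTracialDesignBlockMaskExp

end
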